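import Summits.ABC.IUTFork.Joshi.ATS4MainBoundsPrimesRamification
import Literature.IUT.LogVolume.EtaPrmSixty
import HarnessLib

/-!
# Joshi [ATS IV] (arXiv:2403.10430v2) Prop 6.2.1 is a THEOREM of the tree; Thm 6.1.1 via [IUTchIV] Thm 1.10 at `η_prm = 60`

Proof-only companion of `Joshi/ATS4MainBoundsPrimesRamification.lean` (abc-iut cell, branch E, seat abc-iut-E-t30, slot
T-30; rung LADDER-ABC:A2.E). Joshi's Prop 6.2.1 («for x ≥ η_prm := 60 … π(x) ≤ (4/3)·x/log(x)», p.58 l.32–36), typed as the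
claim-Prop `Summit.ABC.IUTFork.Joshi.ATS4.Prop621` and shown there to BE the tree's predicate
`Literature.IUT.LogVolume.IsEtaPrm 60`, is DISCHARGED: the tree now proves `IsEtaPrm 60`
(`Literature.IUT.LogVolume.EtaPrmSixty.isEtaPrm_sixty` — kernel-certified prime counts below `1024`, Abel summation with
the tree's certified Schoenfeld-form `θ`-table up to `8886113`, Chebyshev–Sylvester beyond; no Dusart input, no named
fact). Consequently the dictionary route of Rmk 6.1.2 needs no prime-number hypothesis: Joshi's Thm 6.1.1 follows from the
tree's kernel-checked [IUTchIV] Thm 1.10 implication given Mochizuki's proof data for the datum, the HYPOTHESIS `Cor312`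
(the real-number content of [IUTchIII] Cor. 3.12 — NOT asserted) and `ℓ ≠ 5`. **No side is taken** on [IUTchIII]
Cor. 3.12 or on any author; the discharged statement is classical (a weak form of Rosser–Schoenfeld 1962 (3.6)).
[claim: Joshi2024ATS4, status: disputed] for the transcription; standard axioms only.
-/

namespace Summit.ABC.IUTFork.Joshi.ATS4

/-- **Prop 6.2.1 holds** ([J-IV] p.58 l.32–36: «For x ≥ η_prm := 60, and let π(x) be the number of primes ≤ x, then one
has π(x) ≤ (4/3)·x/log(x)»): DISCHARGED by the tree's `Literature.IUT.LogVolume.EtaPrmSixty.isEtaPrm_sixty` through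
`prop621_iff_isEtaPrm`. [claim: Joshi2024ATS4, status: disputed] -/
theorem prop621_holds : Summit.ABC.IUTFork.Joshi.ATS4.Prop621 :=
  prop621_iff_isEtaPrm.mpr (by unfold etaPrm; exact Literature.IUT.LogVolume.EtaPrmSixty.isEtaPrm_sixty)

/-- `η_prm := 60` is an admissible «positive real number of [IUTchIV] Prop. 1.6» (`IsEtaPrm etaPrm`), restated at
Joshi's constant `etaPrm`. [claim: Joshi2024ATS4, status: disputed] -/
theorem isEtaPrm_etaPrm : Literature.IUT.LogVolume.IsEtaPrm Summit.ABC.IUTFork.Joshi.ATS4.etaPrm := by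
  unfold etaPrm; exact Literature.IUT.LogVolume.EtaPrmSixty.isEtaPrm_sixty

namespace MainBoundDatum

/-- **Thm 6.1.1 from the tree's [IUTchIV] Thm 1.10 at `η_prm = 60`, with no prime-number hypothesis** (Rmk 6.1.2's
dictionary `toThm110`): given Mochizuki's proof data for the datum, the HYPOTHESIS `Cor312` and `ℓ ≠ 5`, Thm 6.1.1 holds.
Conditional bookkeeping only; no side taken. [claim: Joshi2024ATS4, status: disputed] -/
theorem thm611_of_theorem110' (D : MainBoundDatum) (θ : ℝ) (P : (D.toThm110 θ).ProofData) (hne : D.ell ≠ 5)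
    (hcor : (D.toThm110 θ).Cor312) : D.Thm611 :=
  D.thm611_of_theorem110 θ P prop621_holds hne hcor

end MainBoundDatum

end Summit.ABC.IUTFork.Joshi.ATS4
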